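import Summits.QuantumFields.YangMills.Theorems.UnitScaleGibbsThinRectangleSwap
import Summits.QuantumFields.YangMills.Theorems.UnitScaleGibbsAxialBondLadderDictionary
import Summits.QuantumFields.YangMills.Theorems.UnitScaleGibbsPlaquetteSecondMoment
import HarnessLib

/-!
# `stub_thinRect` of LINE 28 «GrossTransfer» v3: the axial-gauge bond variables of a box of side `n` have second moment
# `≤ C·n/β_K` under the unit-scale Gibbs measure (PERIMETER size), `d = 3`, `SU(2)`

Cell `ym3-torus` (HUMAN RULING D-0037, rung R3), width seat `ym3-torus-px5` gen 10; FILE 6 = assembly of the (THIN-RECT) lane: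
FILE 1/2 ✓`UnitScaleGibbsThinRectanglePerimeter(Gibbs)` (reflection positivity: `1 − ⟨W_{n×1}⟩ ≤ (4n − 3)(1 − ⟨W_{1×1}⟩)`),
FILE 3 ✓`UnitScaleGibbsPlaquetteSecondMoment` (`∫(1 − reTr U(∂p)) ≤ C/β`, β ≥ 8, from the tree's uniform Gaussian tail),
FILE 4 ✓`UnitScaleGibbsAxialBondLadderDictionary` (the dressed bond is a conjugated ladder = product of ≤ 2 conjugated thin rectangles),
FILE 5 ✓`UnitScaleGibbsThinRectangleSwap` (coordinate swap `(0 1)`; length-uniform thin-rectangle bound in the mean plaquette).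

* §1 the comb words in `d = 3` (`T3Family`, `(F.P K).d = 3` by `rfl`): `treeWord (lowPart 1 v) = seg 0 v₀`,
  `treeWord (lowPart 2 v) = seg 1 v₁ ++ seg 0 v₀`, `lowPart 0 v = 0`;
* §2 `gibbs_integral_dist1_sq_axialBond_le_plaq`: for `β ≥ 0`, a box `[lo, hi]` of side `n` with `2n + 6 ≤ sitesPerDir 0` and a box bond
  `b = ⟨castSite x, μ⟩`: `∫ dist1((U^{axialGauge U lo hi}) b)² dμ_β ≤ 64·n·M` whenever the two mean plaquettes `∫(1 − reTr U(∂p₀ⱼ))`,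
  `j = 1, 2`, are `≤ M` (μ = 0: tree bond, `0`; μ = 1: one rectangle in the `(0,1)` plane; μ = 2: rectangles in the `(0,2)` and `(1,2)` planes);
* §3 `exists_gibbs_integral_dist1_sq_axialBond_le`: `∃ C ≥ 0, ∀ F K β ≥ 8, …, ∫ dist1((U^{ax}) b)² d(gibbsMeasure (F.P K) β) ≤ C·n/β`;
  **`stub_thinRect_holds`**: the text of `stub_thinRect` of the v3 draft skeleton (w2-19936 g15, HOME
  `ym-ust-19936-w2/g15/gross_transfer_v3_draft.w2g15.lean` l.187–194) — `∀ L ∃ C ≥ 0 ∃ γ₁ ∈ (0,1], ∀ F γ (F.L = L, 0 < γ ≤ γ₁) K lo hi n,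
  box → 2n + 6 ≤ sitesPerDir 0 → ∀ b ∈ boxBonds lo hi, ∫ dist1((U^{ax}) b)² ∂(gibbsK F ℰp γ K) ≤ C·n·(1 + log (γL^{−K})⁻¹)·(γL^{−K})`
  (`γ₁ = 1/8` so that `β_K ≥ 8`; the logarithm is slack: the true scale is `C·n·β_K⁻¹`).

HONEST: `d = 3`, `SU(2)` (the tree's one-site doubling input); nothing of `stub_linTest` / 23083 / `HistoryTailL` is proved here; the v3
skeleton is a DRAFT (the line owner registers).  Everything here is proved; no definitions.
-/

open MeasureTheory
open scoped Matrix.Norms.L2Operator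

namespace Summit.QuantumFields.YangMills.Theorems.UnitScaleGibbsThinRectStub

open Literature.MathematicalPhysics.QuantumFieldTheory
open Literature.MathematicalPhysics.QuantumFieldTheory.Balaban1983to89
open Literature.MathematicalPhysics.QuantumFieldTheory.Balaban1983to89.T3ContinuumYM3Torus
open Literature.MathematicalPhysics.QuantumFieldTheory.Balaban1983to89.T3UnitScaleTilt
open Literature.MathematicalPhysics.QuantumFieldTheory.Balaban1983to89.T3UnitLawDensityEML (ℰp)
open Literature.MathematicalPhysics.QuantumFieldTheory.Balaban1983to89.B7Prop1Explicit (seg seg_zero treeWord e e_apply)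
open Literature.MathematicalPhysics.QuantumFieldTheory.Balaban1983to89.B8Lemma1NonAbelian (lowPart lowPart_apply e_nonneg)
open Literature.MathematicalPhysics.QuantumFieldTheory.Balaban1983to89.T4AxialGaugeSmallField (castSite axialGauge boxBonds)
open Summit.QuantumFields.YangMills.Theorems.UnitScaleGibbsThinRectangleSwap
open Summit.QuantumFields.YangMills.Theorems.UnitScaleGibbsAxialBondLadderDictionary
open Summit.QuantumFields.YangMills.Theorems.UnitScaleGibbsPlaquetteSecondMoment

noncomputable section

variable (F : T3Family) (K : ℕ)

/-! ## §1 The comb words in three dimensions -/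

/-- The directions of `T^{(0)}_K` in descending order are `[2, 1, 0]` (`d = 3`). [folklore] -/
theorem finRange_d_reverse : (List.finRange (F.P K).d).reverse = [2, 1, 0] := by rfl

/-- Every direction of `T^{(0)}_K` is `0`, `1` or `2`. [folklore] -/
theorem dir_cases (μ : Fin (F.P K).d) : μ = 0 ∨ μ = 1 ∨ μ = 2 := by
  rcases μ with ⟨k, hk⟩
  have hk3 : k < 3 := hk
  interval_cases k
  · exact Or.inl rfl
  · exact Or.inr (Or.inl rfl)
  · exact Or.inr (Or.inr rfl)

/-- No coordinate lies below direction `0`: `lowPart 0 v = 0` (direction-`0` bonds are tree bonds). [folklore] -/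
theorem lowPart_zero_dir (v : Fin (F.P K).d → ℤ) : lowPart (0 : Fin (F.P K).d) v = 0 := by
  funext κ
  rw [lowPart_apply, if_neg (fun h => absurd (Fin.lt_def.mp h) (by simp))]
  rfl

/-- The comb word below direction `1` is the straight segment `seg 0 v₀`. [folklore] -/
theorem treeWord_lowPart_one (v : Fin (F.P K).d → ℤ) :
    treeWord (lowPart (1 : Fin (F.P K).d) v) = seg 0 (v 0) := by
  rw [treeWord, finRange_d_reverse]
  simp [List.flatMap_cons, lowPart_apply]

/-- The comb word below direction `2` is the L-shaped `seg 1 v₁ ++ seg 0 v₀`. [folklore] -/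
theorem treeWord_lowPart_two (v : Fin (F.P K).d → ℤ) :
    treeWord (lowPart (2 : Fin (F.P K).d) v) = seg 1 (v 1) ++ seg 0 (v 0) := by
  rw [treeWord, finRange_d_reverse]
  simp [List.flatMap_cons, lowPart_apply]
  rfl

/-! ## §2 The second moment of a dressed box bond in the mean plaquette (`β ≥ 0`) -/

/-- Box coordinates: `0 ≤ (x − lo) κ ≤ n` for a bond `⟨x, x + e_μ⟩` of a box of side `n`. [folklore] -/
theorem sub_lo_bounds {lo hi x : Fin (F.P K).d → ℤ} {n : ℕ} {μ : Fin (F.P K).d}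
    (hbox : ∀ κ, lo κ ≤ hi κ ∧ hi κ ≤ lo κ + n) (hx : lo ≤ x) (hxμ : x + e μ ≤ hi) (κ : Fin (F.P K).d) :
    0 ≤ (x - lo) κ ∧ ((x - lo) κ).toNat ≤ n := by
  have h1 : lo κ ≤ x κ := hx κ
  have h2 : x κ + e μ κ ≤ hi κ := hxμ κ
  have h3 : 0 ≤ e μ κ := e_nonneg μ κ
  have h4 := (hbox κ).2
  refine ⟨by simp only [Pi.sub_apply]; linarith, ?_⟩
  have h5 : (x - lo) κ ≤ n := by simp only [Pi.sub_apply]; linarith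
  exact (Int.toNat_le.mpr h5)

/-- **THE DRESSED BOND IN THE MEAN PLAQUETTE** (`d = 3`, `SU(N)`, `β ≥ 0`): for a box `[lo, hi]` of side `n` with `2n + 6 ≤ sitesPerDir 0`,
a box bond `⟨castSite x, μ⟩` (`lo ≤ x`, `x + e_μ ≤ hi`), and `M` dominating the two mean plaquettes `∫(1 − reTr U(∂p₀ⱼ)) dμ_β`, `j = 1, 2`:
`∫ dist1((U^{axialGauge U lo hi}) b)² dμ_β ≤ 64·N·n·M` (μ = 0: `0`; μ = 1: one `v₀ × 1` rectangle of the `(0,1)` plane, `≤ 8N n M`;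
μ = 2: `2·(8N n M) + 2·(8N n M)` from the `(0,2)`- and `(1,2)`-plane legs). [cite: SeilerLNP1982, §2 (static quark potential and string tension from reflection positivity)] -/
theorem gibbs_integral_dist1_sq_axialBond_le_plaq {N : ℕ} [NeZero N] {β : ℝ} (hβ : 0 ≤ β)
    {lo hi : Fin (F.P K).d → ℤ} {n : ℕ} (hbox : ∀ κ, lo κ ≤ hi κ ∧ hi κ ≤ lo κ + n) (hn : 2 * n + 6 ≤ (F.P K).sitesPerDir 0)
    {x : Fin (F.P K).d → ℤ} {μ : Fin (F.P K).d} (hx : lo ≤ x) (hxμ : x + e μ ≤ hi) {M : ℝ}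
    (hM : ∀ (j : Fin (F.P K).d) (hj : 0 < j), ∫ U : GaugeField (F.P K) 0 (Matrix.specialUnitaryGroup (Fin N) ℂ),
      (1 - reTr (GaugeField.plaqHol U ⟨(0 : Literature.MathematicalPhysics.QuantumFieldTheory.Site (F.P K).d ((F.P K).sitesPerDir 0)),
        0, j, hj⟩)) ∂(T4GenFunBounds.gibbsMeasure (F.P K) β) ≤ M) :
    ∫ U : GaugeField (F.P K) 0 (Matrix.specialUnitaryGroup (Fin N) ℂ),
        dist1 (GaugeField.gaugeAct (axialGauge U lo hi) U ⟨castSite x, μ⟩) ^ 2 ∂(T4GenFunBounds.gibbsMeasure (F.P K) β) ≤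
      64 * N * n * M := by
  haveI := T4GenFunBounds.isProbabilityMeasure_gibbsMeasure (G := Matrix.specialUnitaryGroup (Fin N) ℂ) (F.P K) hβ
  have hN : ∀ κ, hi κ - lo κ < (F.P K).sitesPerDir 0 := fun κ => by have := (hbox κ).2; omega
  have hn₀ : 2 * n + 4 ≤ (F.P K).sitesPerDir 0 := by omega
  have h01 : (0 : Fin (F.P K).d) < 1 := by exact (by decide : (0 : Fin 3) < 1)
  have h02 : (0 : Fin (F.P K).d) < 2 := by exact (by decide : (0 : Fin 3) < 2)
  have h21 : (2 : Fin (F.P K).d) ≠ 1 := by exact (by decide : (2 : Fin 3) ≠ 1)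
  have hM0 : 0 ≤ M := (integral_nonneg fun U => sub_nonneg.2 (GaugeGroup.reTr_le_one _)).trans (hM 1 h01)
  have hNn : (0 : ℝ) ≤ 64 * N * n * M := by positivity
  set v : Fin (F.P K).d → ℤ := x - lo with hv
  have hvb := sub_lo_bounds F K hbox hx hxμ
  have hv0 : ∀ κ, v κ = (((v κ).toNat : ℕ) : ℤ) := fun κ => (Int.toNat_of_nonneg (hvb κ).1).symm
  rcases dir_cases F K μ with rfl | rfl | rfl
  · -- μ = 0: tree bond
    have h0 : ∀ U : GaugeField (F.P K) 0 (Matrix.specialUnitaryGroup (Fin N) ℂ),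
        dist1 (GaugeField.gaugeAct (axialGauge U lo hi) U ⟨castSite x, 0⟩) ^ 2 = 0 := fun U => by
      rw [dist1_gaugeAct_axialGauge_eq_zero_of_lowPart_eq_zero U hN hx hxμ (lowPart_zero_dir F K _), zero_pow two_ne_zero]
    simp only [h0, integral_zero]
    exact hNn
  · -- μ = 1: one rectangle in the (0,1) plane
    have hQ : treeWord (lowPart (1 : Fin (F.P K).d) (x - lo)) = seg 0 (((v 0).toNat : ℕ) : ℤ) := by
      rw [treeWord_lowPart_one, ← hv, ← hv0]
    have hpt : ∀ U : GaugeField (F.P K) 0 (Matrix.specialUnitaryGroup (Fin N) ℂ),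
        dist1 (GaugeField.gaugeAct (axialGauge U lo hi) U ⟨castSite x, 1⟩) ^ 2 ≤
          dist1 (rectangleHolonomy (toConfig U) (castSite (x - lowPart 1 (x - lo)) : Site (F.P K) 0) 0 1 (v 0).toNat 1) ^ 2 :=
      fun U => pow_le_pow_left₀ (GaugeGroup.dist1_nonneg _) (dist1_gaugeAct_axialGauge_le_of_treeWord_eq_seg U hN hx hxμ hQ) 2
    calc ∫ U : GaugeField (F.P K) 0 (Matrix.specialUnitaryGroup (Fin N) ℂ),
          dist1 (GaugeField.gaugeAct (axialGauge U lo hi) U ⟨castSite x, 1⟩) ^ 2 ∂(T4GenFunBounds.gibbsMeasure (F.P K) β)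
        ≤ ∫ U : GaugeField (F.P K) 0 (Matrix.specialUnitaryGroup (Fin N) ℂ),
            dist1 (rectangleHolonomy (toConfig U) (castSite (x - lowPart 1 (x - lo)) : Site (F.P K) 0) 0 1 (v 0).toNat 1) ^ 2
            ∂(T4GenFunBounds.gibbsMeasure (F.P K) β) :=
          integral_mono_of_nonneg (ae_of_all _ fun U => sq_nonneg _) (integrable_dist1_sq_rect (F.P K) hβ _ 0 1 _ 1)
            (ae_of_all _ hpt)
      _ ≤ 8 * N * n * M :=
          (gibbs_integral_dist1_sq_thinRect_le_plaq (F.P K) hβ h01 (hvb 0).2 hn₀ _).trans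
            (mul_le_mul_of_nonneg_left (hM 1 h01) (by positivity))
      _ ≤ 64 * N * n * M := by nlinarith
  · -- μ = 2: the L-shaped ladder = two rectangles, planes (0,2) and (1,2)
    have hQ : treeWord (lowPart (2 : Fin (F.P K).d) (x - lo)) =
        seg 1 (((v 1).toNat : ℕ) : ℤ) ++ seg 0 (((v 0).toNat : ℕ) : ℤ) := by
      rw [treeWord_lowPart_two, ← hv, ← hv0, ← hv0]
    set zA : Site (F.P K) 0 := castSite (x - lowPart 2 (x - lo) + (((v 1).toNat : ℕ) : ℤ) • e 1) with hzA
    set zB : Site (F.P K) 0 := castSite (x - lowPart 2 (x - lo)) with hzB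
    have hpt : ∀ U : GaugeField (F.P K) 0 (Matrix.specialUnitaryGroup (Fin N) ℂ),
        dist1 (GaugeField.gaugeAct (axialGauge U lo hi) U ⟨castSite x, 2⟩) ^ 2 ≤
          2 * dist1 (rectangleHolonomy (toConfig U) zA 0 2 (v 0).toNat 1) ^ 2 +
          2 * dist1 (rectangleHolonomy (toConfig U) zB 1 2 (v 1).toNat 1) ^ 2 :=
      fun U => dist1_sq_gaugeAct_axialGauge_le_of_treeWord_eq_seg_append_seg U hN hx hxμ hQ
    have hiA := integrable_dist1_sq_rect (N := N) (F.P K) hβ zA 0 2 (v 0).toNat 1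
    have hiB := integrable_dist1_sq_rect (N := N) (F.P K) hβ zB 1 2 (v 1).toNat 1
    have hint : Integrable (fun U : GaugeField (F.P K) 0 (Matrix.specialUnitaryGroup (Fin N) ℂ) =>
        2 * dist1 (rectangleHolonomy (toConfig U) zA 0 2 (v 0).toNat 1) ^ 2 +
          2 * dist1 (rectangleHolonomy (toConfig U) zB 1 2 (v 1).toNat 1) ^ 2) (T4GenFunBounds.gibbsMeasure (F.P K) β) :=
      (hiA.const_mul 2).add (hiB.const_mul 2)
    have hA := gibbs_integral_dist1_sq_thinRect_le_plaq (N := N) (F.P K) hβ h02 (hvb 0).2 hn₀ zA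
    have hB := gibbs_integral_dist1_sq_thinRect_one_le_plaq (N := N) (F.P K) hβ h02 h21 (hvb 1).2 hn₀ zB
    have hM2 := hM 2 h02
    calc ∫ U : GaugeField (F.P K) 0 (Matrix.specialUnitaryGroup (Fin N) ℂ),
          dist1 (GaugeField.gaugeAct (axialGauge U lo hi) U ⟨castSite x, 2⟩) ^ 2 ∂(T4GenFunBounds.gibbsMeasure (F.P K) β)
        ≤ ∫ U : GaugeField (F.P K) 0 (Matrix.specialUnitaryGroup (Fin N) ℂ),
            (2 * dist1 (rectangleHolonomy (toConfig U) zA 0 2 (v 0).toNat 1) ^ 2 +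
              2 * dist1 (rectangleHolonomy (toConfig U) zB 1 2 (v 1).toNat 1) ^ 2) ∂(T4GenFunBounds.gibbsMeasure (F.P K) β) :=
          integral_mono_of_nonneg (ae_of_all _ fun U => sq_nonneg _) hint (ae_of_all _ hpt)
      _ = 2 * ∫ U : GaugeField (F.P K) 0 (Matrix.specialUnitaryGroup (Fin N) ℂ),
              dist1 (rectangleHolonomy (toConfig U) zA 0 2 (v 0).toNat 1) ^ 2 ∂(T4GenFunBounds.gibbsMeasure (F.P K) β) +
          2 * ∫ U : GaugeField (F.P K) 0 (Matrix.specialUnitaryGroup (Fin N) ℂ),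
              dist1 (rectangleHolonomy (toConfig U) zB 1 2 (v 1).toNat 1) ^ 2 ∂(T4GenFunBounds.gibbsMeasure (F.P K) β) := by
          rw [integral_add (hiA.const_mul 2) (hiB.const_mul 2), integral_const_mul, integral_const_mul]
      _ ≤ 2 * (8 * N * n * M) + 2 * (8 * N * n * M) := by
          have hA' := hA.trans (mul_le_mul_of_nonneg_left hM2 (by positivity))
          have hB' := hB.trans (mul_le_mul_of_nonneg_left hM2 (by positivity))
          linarith
      _ ≤ 64 * N * n * M := by nlinarith

/-! ## §3 The constants: `SU(2)`, `β ≥ 8`, and the text of `stub_thinRect` -/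

/-- **THE DRESSED BOND, SECOND MOMENT, SHARP SCALE**: `∃ C ≥ 0, ∀ F K β, 8 ≤ β →` for every box `[lo, hi]` of side `n` with
`2n + 6 ≤ sitesPerDir 0` and every box bond `b`, `∫ dist1((U^{axialGauge U lo hi}) b)² d(gibbsMeasure (F.P K) β) ≤ C·n/β`
(`C = 128·C₃`, `C₃` of ✓`exists_integral_one_sub_reTr_le_uniform_T3`). [cite: SeilerLNP1982, §2 (static quark potential and string tension from reflection positivity); Balaban1985UV3, (11) p.258] -/
theorem exists_gibbs_integral_dist1_sq_axialBond_le :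
    ∃ C : ℝ, 0 ≤ C ∧ ∀ (F : T3Family) (K : ℕ) (β : ℝ), 8 ≤ β → ∀ (lo hi : Fin (F.P K).d → ℤ) (n : ℕ),
      (∀ κ, lo κ ≤ hi κ ∧ hi κ ≤ lo κ + n) → 2 * n + 6 ≤ (F.P K).sitesPerDir 0 →
      ∀ b : PBond (F.P K) 0, b ∈ (boxBonds lo hi : Set (PBond (F.P K) 0)) →
        ∫ U : GaugeField (F.P K) 0 (Matrix.specialUnitaryGroup (Fin 2) ℂ),
            dist1 (GaugeField.gaugeAct (axialGauge U lo hi) U b) ^ 2 ∂(T4GenFunBounds.gibbsMeasure (F.P K) β) ≤ C * n / β := by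
  obtain ⟨C₃, hC₃0, hC₃⟩ := exists_integral_one_sub_reTr_le_uniform_T3
  refine ⟨64 * 2 * C₃, by positivity, fun F K β hβ lo hi n hbox hn b hb => ?_⟩
  have hβ0 : 0 ≤ β := by linarith
  obtain ⟨x, hx, hxμ, hsrc⟩ := hb
  obtain ⟨src, μ⟩ := b
  simp only at hsrc hxμ
  subst hsrc
  have hM : ∀ (j : Fin (F.P K).d) (hj : 0 < j), ∫ U : GaugeField (F.P K) 0 (Matrix.specialUnitaryGroup (Fin 2) ℂ),
      (1 - reTr (GaugeField.plaqHol U ⟨(0 : Literature.MathematicalPhysics.QuantumFieldTheory.Site (F.P K).d ((F.P K).sitesPerDir 0)),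
        0, j, hj⟩)) ∂(T4GenFunBounds.gibbsMeasure (F.P K) β) ≤ C₃ / β := fun j hj => hC₃ F K β hβ _
  have h := gibbs_integral_dist1_sq_axialBond_le_plaq F K (N := 2) hβ0 hbox hn hx hxμ hM
  refine h.trans (le_of_eq ?_)
  push_cast
  ring

/-- ★★★ **`stub_thinRect` OF THE v3 DRAFT SKELETON OF LINE 28 «GrossTransfer», AS PRINTED** (w2-19936 g15, `gross_transfer_v3_draft` l.187–194):
for every `L` there are `C ≥ 0` and `γ₁ ∈ (0, 1]` (`γ₁ = 1/8`) such that for every `T3Family F` with `F.L = L`, every `0 < γ ≤ γ₁`, every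
cut-off `K`, every box `[lo, hi]` of side `n` with `2n + 6 ≤ sitesPerDir 0` and every box bond `b`,
`∫ dist1((U^{axialGauge U lo hi}) b)² ∂(gibbsK F ℰp γ K) ≤ C·n·(1 + log (γL^{−K})⁻¹)·(γL^{−K})` — the PERIMETER-size second moment of the
axial-gauge bond variables (reflection positivity + ladder dictionary + sharp mean plaquette; the logarithm is slack).
[cite: SeilerLNP1982, §2 (static quark potential and string tension from reflection positivity); Balaban1985Averaging, pp.24–25; Balaban1985UV3, (11) p.258] -/
theorem stub_thinRect_holds :
    ∀ (L : ℕ), ∃ C : ℝ, 0 ≤ C ∧ ∃ γ₁ : ℝ, 0 < γ₁ ∧ γ₁ ≤ 1 ∧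
        ∀ (F : T3Family) (γ : ℝ), F.L = L → 0 < γ → γ ≤ γ₁ → ∀ (K : ℕ) (lo hi : Fin (F.P K).d → ℤ) (n : ℕ),
          (∀ κ, lo κ ≤ hi κ ∧ hi κ ≤ lo κ + n) → 2 * n + 6 ≤ (F.P K).sitesPerDir 0 →
          ∀ b : PBond (F.P K) 0, b ∈ (boxBonds lo hi : Set (PBond (F.P K) 0)) →
            ∫ U, (GaugeGroup.dist1 (GaugeField.gaugeAct (axialGauge U lo hi) U b)) ^ 2 ∂(gibbsK F ℰp γ K)
              ≤ C * n * (1 + Real.log (γ * ((L : ℝ)⁻¹) ^ K)⁻¹) * (γ * ((L : ℝ)⁻¹) ^ K) := by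
  obtain ⟨C, hC0, hC⟩ := exists_gibbs_integral_dist1_sq_axialBond_le
  intro L
  refine ⟨C, hC0, 1 / 8, by norm_num, by norm_num, fun F γ hFL hγ hγ1 K lo hi n hbox hn b hb => ?_⟩
  -- `x = γ L^{-K} ∈ (0, 1/8]`, `β_K = x⁻¹ ≥ 8`
  set x : ℝ := γ * ((L : ℝ)⁻¹) ^ K with hxdef
  have hL1 : (1 : ℝ) ≤ L := by rw [← hFL]; exact_mod_cast F.hL.2.le
  have hx0 : 0 < x := by
    have : (0 : ℝ) < ((L : ℝ)⁻¹) ^ K := pow_pos (inv_pos.2 (by linarith)) K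
    exact mul_pos hγ this
  have hxγ : x ≤ γ := by
    have h1 : ((L : ℝ)⁻¹) ^ K ≤ 1 := pow_le_one₀ (by positivity) (inv_le_one_of_one_le₀ hL1)
    calc x = γ * ((L : ℝ)⁻¹) ^ K := rfl
      _ ≤ γ * 1 := mul_le_mul_of_nonneg_left h1 hγ.le
      _ = γ := mul_one _
  have hx1 : x ≤ 1 := hxγ.trans (hγ1.trans (by norm_num))
  have hβeq : (F.scheme ℰp γ).β K = x⁻¹ := by rw [hxdef, ← hFL]; rfl
  have hβ8 : 8 ≤ (F.scheme ℰp γ).β K := by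
    rw [hβeq]
    exact le_inv_of_le_inv₀ hx0 (by linarith)
  have h := hC F K ((F.scheme ℰp γ).β K) hβ8 lo hi n hbox hn b hb
  rw [← gibbsK_eq] at h
  refine h.trans ?_
  rw [hβeq, div_inv_eq_mul]
  -- `C n x ≤ C n (1 + log x⁻¹) x` since `log x⁻¹ ≥ 0`
  have hlog : 0 ≤ Real.log x⁻¹ := Real.log_nonneg (one_le_inv_iff₀.2 ⟨hx0, hx1⟩)
  have hCn : 0 ≤ C * n * x := by positivity
  nlinarith

/-- ★★★ **`stub_thinRect` OF THE v3.2 DRAFT SKELETON OF LINE 28 «GrossTransfer» (THE SLACK LOGARITHM DROPPED), AS PRINTED** (w2-19936 g15,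
`gross_transfer_v32_draft` l.187–193; appended by w3-19936 g18 on the pen of record's v3.2 (i), px5 g10 having closed): for every `L` there are
`C ≥ 0` and `γ₁ ∈ (0, 1]` (`γ₁ = 1/8`) such that for every `T3Family F` with `F.L = L`, every `0 < γ ≤ γ₁`, every cut-off `K`, every box `[lo, hi]`
of side `n` with `2n + 6 ≤ sitesPerDir 0` and every box bond `b`, `∫ dist1((U^{axialGauge U lo hi}) b)² ∂(gibbsK F ℰp γ K) ≤ C·n·(γL^{−K})` — the
SHARP perimeter-size second moment (`exists_gibbs_integral_dist1_sq_axialBond_le` at `β_K = (γL^{−K})⁻¹ ≥ 8`), γ-uniform as the v3.2 windows need.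
[cite: SeilerLNP1982, §2 (static quark potential and string tension from reflection positivity); Balaban1985Averaging, pp.24–25; Balaban1985UV3, (11) p.258] -/
theorem stub_thinRect_holds' :
    ∀ (L : ℕ), ∃ C : ℝ, 0 ≤ C ∧ ∃ γ₁ : ℝ, 0 < γ₁ ∧ γ₁ ≤ 1 ∧
        ∀ (F : T3Family) (γ : ℝ), F.L = L → 0 < γ → γ ≤ γ₁ → ∀ (K : ℕ) (lo hi : Fin (F.P K).d → ℤ) (n : ℕ),
          (∀ κ, lo κ ≤ hi κ ∧ hi κ ≤ lo κ + n) → 2 * n + 6 ≤ (F.P K).sitesPerDir 0 →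
          ∀ b : PBond (F.P K) 0, b ∈ (boxBonds lo hi : Set (PBond (F.P K) 0)) →
            ∫ U, (GaugeGroup.dist1 (GaugeField.gaugeAct (axialGauge U lo hi) U b)) ^ 2 ∂(gibbsK F ℰp γ K)
              ≤ C * n * (γ * ((L : ℝ)⁻¹) ^ K) := by
  obtain ⟨C, hC0, hC⟩ := exists_gibbs_integral_dist1_sq_axialBond_le
  intro L
  refine ⟨C, hC0, 1 / 8, by norm_num, by norm_num, fun F γ hFL hγ hγ1 K lo hi n hbox hn b hb => ?_⟩
  -- `x = γ L^{-K} ∈ (0, 1/8]`, `β_K = x⁻¹ ≥ 8`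
  set x : ℝ := γ * ((L : ℝ)⁻¹) ^ K with hxdef
  have hL1 : (1 : ℝ) ≤ L := by rw [← hFL]; exact_mod_cast F.hL.2.le
  have hx0 : 0 < x := by
    have : (0 : ℝ) < ((L : ℝ)⁻¹) ^ K := pow_pos (inv_pos.2 (by linarith)) K
    exact mul_pos hγ this
  have hxγ : x ≤ γ := by
    have h1 : ((L : ℝ)⁻¹) ^ K ≤ 1 := pow_le_one₀ (by positivity) (inv_le_one_of_one_le₀ hL1)
    calc x = γ * ((L : ℝ)⁻¹) ^ K := rfl
      _ ≤ γ * 1 := mul_le_mul_of_nonneg_left h1 hγ.le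
      _ = γ := mul_one _
  have hβeq : (F.scheme ℰp γ).β K = x⁻¹ := by rw [hxdef, ← hFL]; rfl
  have hβ8 : 8 ≤ (F.scheme ℰp γ).β K := by
    rw [hβeq]
    exact le_inv_of_le_inv₀ hx0 (by linarith [hxγ.trans hγ1])
  have h := hC F K ((F.scheme ℰp γ).β K) hβ8 lo hi n hbox hn b hb
  rw [← gibbsK_eq] at h
  refine h.trans (le_of_eq ?_)
  rw [hβeq, div_inv_eq_mul]

end

end Summit.QuantumFields.YangMills.Theorems.UnitScaleGibbsThinRectStub
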